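import Literature.Analysis.FluidPDE.TaoCascadeWaveletFourier
import Literature.Analysis.FluidPDE.TaoCascadeProjection
import Literature.Analysis.FunctionSpaces.FourierSobolevNormProofs
import HarnessLib

/-!
# Tao's averaged Navier–Stokes blow-up: a priori bounds for mild `H¹⁰` solutions (Lemma 4.1 (4.6)–(4.7))

T. Tao, *Finite time blowup for an averaged three-dimensional Navier–Stokes equation*,
J. Amer. Math. Soc. **29** (2016), 601–674 = arXiv:1402.0290v3 (held as `paper:arxiv-1402.0290`),
§4, proof of Lemma 4.1, p. 22: "from the a priori regularity `u ∈ C⁰_t H¹⁰_x` we obtain (4.6)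
from the Plancherel identity … from Plancherel and the `C⁰_t H¹⁰_x` bound on `u` we have (4.7)".

Support file (theorems only) for the discharge of the named fact `equationsOfMotion`
(`TaoCascadeMotion.lean`), over the accepted setting (`ContinuousInH10On`, `eFourierSobolevNorm`,
`modeProjection`, `freqRegion`):

* `eFourierSobolevNorm_add_le`, `eFourierSobolevNorm_neg` — the `H^s` norm is a seminorm
  (Minkowski on the Fourier side, via the accepted `eFourierSobolevNorm_eq_eLpNorm`);
* `ContinuousInH10On.continuousWithinAt`, `ContinuousInH10On.continuousOn` — an `H¹⁰`-continuous
  curve is `L²`-continuous;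
* `ContinuousInH10On.exists_forall_Icc_le` — **the `C⁰_t H¹⁰_x` bound**: an `H¹⁰`-continuous curve
  with finite `H¹⁰` norms is bounded in `H¹⁰` on every compact time interval `[0,T]`;
* `mul_enorm_modeProjection_le` — **(4.7) on the Fourier side**:
  `(1+ε₀)^{10n} ‖u_{i,n}‖_{L²} ≤ ‖u‖_{H¹⁰}` (on the region of the mode `(i,n)` one has
  `|ξ| > (1+ε₀)ⁿ`), `enorm_modeProjection_le` — `‖u_{i,n}‖ ≤ ‖u‖_{H¹⁰}`, and the real form
  `one_add_mul_norm_modeProjection_le`.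

## References

* T. Tao, J. Amer. Math. Soc. 29 (2016), 601–674, arXiv:1402.0290v3, §4 Lemma 4.1 (4.6)–(4.7),
  p. 22. Key `Tao2016AveragedNS`.
-/

noncomputable section

open MeasureTheory Set Filter FourierTransform Metric
open scoped ENNReal NNReal Topology

namespace Literature.Analysis.FluidPDE.Tao2016

/-! ### The `H^s` norm is a seminorm -/

/-- The Fourier-side weight function `ξ ↦ (1+|ξ|²)^{s/2} 𝓕f(ξ)` whose `L²` norm is `‖f‖_{H^s}`
is a.e.-strongly measurable. [folklore] -/
theorem aestronglyMeasurable_sobolevWeight_smul (s : ℝ) (f : L2C) :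
    AEStronglyMeasurable (fun ξ : (EuclideanSpace ℝ (Fin 3)) => ((1 + ‖ξ‖ ^ 2) ^ (s / 2) : ℝ) •
      ((𝓕 f : L2C) : (EuclideanSpace ℝ (Fin 3)) → (EuclideanSpace ℂ (Fin 3))) ξ) volume :=
  (Function.hasTemperateGrowth_one_add_norm_sq_rpow (EuclideanSpace ℝ (Fin 3)) (s / 2)).1.continuous.aestronglyMeasurable.smul
    (Lp.aestronglyMeasurable _)

/-- **Triangle inequality for the `H^s` norm**: `‖f + g‖_{H^s} ≤ ‖f‖_{H^s} + ‖g‖_{H^s}`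
(Minkowski in the weighted `L²` on the Fourier side). [folklore] -/
theorem eFourierSobolevNorm_add_le (s : ℝ) (f g : L2C) :
    FunctionSpaces.eFourierSobolevNorm s (f + g) ≤
      FunctionSpaces.eFourierSobolevNorm s f + FunctionSpaces.eFourierSobolevNorm s g := by
  rw [FunctionSpaces.eFourierSobolevNorm_eq_eLpNorm, FunctionSpaces.eFourierSobolevNorm_eq_eLpNorm,
    FunctionSpaces.eFourierSobolevNorm_eq_eLpNorm]
  have hadd : (fun ξ : (EuclideanSpace ℝ (Fin 3)) => ((1 + ‖ξ‖ ^ 2) ^ (s / 2) : ℝ) • ((𝓕 (f + g) : L2C) : (EuclideanSpace ℝ (Fin 3)) → (EuclideanSpace ℂ (Fin 3))) ξ) =ᵐ[volume]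
      (fun ξ : (EuclideanSpace ℝ (Fin 3)) => ((1 + ‖ξ‖ ^ 2) ^ (s / 2) : ℝ) • ((𝓕 f : L2C) : (EuclideanSpace ℝ (Fin 3)) → (EuclideanSpace ℂ (Fin 3))) ξ) +
        fun ξ : (EuclideanSpace ℝ (Fin 3)) => ((1 + ‖ξ‖ ^ 2) ^ (s / 2) : ℝ) • ((𝓕 g : L2C) : (EuclideanSpace ℝ (Fin 3)) → (EuclideanSpace ℂ (Fin 3))) ξ := by
    filter_upwards [fourierFn_add f g] with ξ hξ
    change ((1 + ‖ξ‖ ^ 2) ^ (s / 2) : ℝ) • fourierFn (f + g) ξ =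
      ((1 + ‖ξ‖ ^ 2) ^ (s / 2) : ℝ) • fourierFn f ξ + ((1 + ‖ξ‖ ^ 2) ^ (s / 2) : ℝ) • fourierFn g ξ
    rw [hξ, smul_add]
  rw [eLpNorm_congr_ae hadd]
  exact eLpNorm_add_le (aestronglyMeasurable_sobolevWeight_smul s f)
    (aestronglyMeasurable_sobolevWeight_smul s g) one_le_two

/-- The `H^s` norm is invariant under `f ↦ -f`. [folklore] -/
theorem eFourierSobolevNorm_neg (s : ℝ) (f : L2C) :
    FunctionSpaces.eFourierSobolevNorm s (-f) = FunctionSpaces.eFourierSobolevNorm s f := by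
  rw [eFourierSobolevNorm_eq, eFourierSobolevNorm_eq, ← neg_one_smul ℂ f,
    sobolevWeightIntegral_congr_ae (fourierFn_smul (-1) f), sobolevWeightIntegral_smul]
  simp

/-- `‖f - g‖_{H^s} = ‖g - f‖_{H^s}`. [folklore] -/
theorem eFourierSobolevNorm_sub_comm (s : ℝ) (f g : L2C) :
    FunctionSpaces.eFourierSobolevNorm s (f - g) = FunctionSpaces.eFourierSobolevNorm s (g - f) := by
  rw [← neg_sub, eFourierSobolevNorm_neg]

/-- `‖f‖_{H^s} ≤ ‖g‖_{H^s} + ‖f - g‖_{H^s}`. [folklore] -/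
theorem eFourierSobolevNorm_le_add_sub (s : ℝ) (f g : L2C) :
    FunctionSpaces.eFourierSobolevNorm s f ≤
      FunctionSpaces.eFourierSobolevNorm s g + FunctionSpaces.eFourierSobolevNorm s (f - g) := by
  have h := eFourierSobolevNorm_add_le s g (f - g)
  rwa [add_sub_cancel] at h

/-- `‖f‖_{L²} ≤ ‖f‖_{H^s}` for `s ≥ 0` (the weight `(1+|ξ|²)^s` is at least `1`). [folklore] -/
theorem enorm_le_eFourierSobolevNorm {s : ℝ} (hs : 0 ≤ s) (f : L2C) :
    ‖f‖ₑ ≤ FunctionSpaces.eFourierSobolevNorm s f := by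
  rw [← FunctionSpaces.eFourierSobolevNorm_zero_eq_enorm]
  unfold FunctionSpaces.eFourierSobolevNorm
  refine ENNReal.rpow_le_rpow (lintegral_mono fun ξ => ?_) (by norm_num)
  gcongr
  exact le_add_of_nonneg_right (sq_nonneg _)

/-- `‖f‖_{L²} ≤ ‖f‖_{H¹⁰}` in real numbers, for `f` of finite `H¹⁰` norm. [folklore] -/
theorem norm_le_eFourierSobolevNorm_toReal {f : L2C} (hf : FunctionSpaces.eFourierSobolevNorm 10 f < ∞) :
    ‖f‖ ≤ (FunctionSpaces.eFourierSobolevNorm 10 f).toReal := by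
  have h := ENNReal.toReal_mono hf.ne (enorm_le_eFourierSobolevNorm (by norm_num : (0 : ℝ) ≤ 10) f)
  rwa [toReal_enorm] at h

/-! ### `H¹⁰`-continuous curves -/

/-- **An `H¹⁰`-continuous curve is `L²`-continuous** (within the same time set). [folklore] -/
theorem ContinuousInH10On.continuousWithinAt {I : Set ℝ} {u : ℝ → L2C} (hu : ContinuousInH10On I u)
    {t₀ : ℝ} (ht₀ : t₀ ∈ I) : ContinuousWithinAt u I t₀ := by
  rw [ContinuousWithinAt, tendsto_iff_edist_tendsto_0]
  refine tendsto_of_tendsto_of_tendsto_of_le_of_le tendsto_const_nhds (hu t₀ ht₀)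
    (fun _ => zero_le) fun t => ?_
  rw [edist_eq_enorm_sub]
  exact enorm_le_eFourierSobolevNorm (by norm_num) _

/-- An `H¹⁰`-continuous curve is `L²`-continuous on its time set. [folklore] -/
theorem ContinuousInH10On.continuousOn {I : Set ℝ} {u : ℝ → L2C} (hu : ContinuousInH10On I u) :
    ContinuousOn u I :=
  fun _ ht => hu.continuousWithinAt ht

/-- The real-valued `H¹⁰` norm along an `H¹⁰`-continuous curve with finite norms is continuous
(within the time set). [folklore] -/
theorem ContinuousInH10On.continuousOn_toReal {I : Set ℝ} {u : ℝ → L2C} (hu : ContinuousInH10On I u)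
    (hfin : ∀ t ∈ I, FunctionSpaces.eFourierSobolevNorm 10 (u t) < ∞) :
    ContinuousOn (fun t => (FunctionSpaces.eFourierSobolevNorm 10 (u t)).toReal) I := by
  intro t₀ ht₀
  rw [ContinuousWithinAt, Metric.tendsto_nhds]
  intro ε hε
  -- the `H¹⁰` distance to `u t₀` is eventually `< ε`
  have hd : ∀ᶠ t in 𝓝[I] t₀, FunctionSpaces.eFourierSobolevNorm 10 (u t - u t₀) < ENNReal.ofReal ε :=
    (tendsto_order.1 (hu t₀ ht₀)).2 _ (ENNReal.ofReal_pos.2 hε)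
  filter_upwards [hd, self_mem_nhdsWithin] with t h1 h2
  have hft := hfin t h2
  have hf₀ := hfin t₀ ht₀
  have hlt : FunctionSpaces.eFourierSobolevNorm 10 (u t - u t₀) < ∞ := h1.trans ENNReal.ofReal_lt_top
  rw [Real.dist_eq, abs_sub_lt_iff]
  have e1 := eFourierSobolevNorm_le_add_sub 10 (u t) (u t₀)
  have e2 := eFourierSobolevNorm_le_add_sub 10 (u t₀) (u t)
  rw [eFourierSobolevNorm_sub_comm] at e2
  have hdlt : (FunctionSpaces.eFourierSobolevNorm 10 (u t - u t₀)).toReal < ε := by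
    rw [← ENNReal.ofReal_lt_ofReal_iff hε] at *
    rwa [ENNReal.ofReal_toReal hlt.ne]
  constructor
  · have := ENNReal.toReal_mono (ENNReal.add_lt_top.2 ⟨hf₀, hlt⟩).ne e1
    rw [ENNReal.toReal_add hf₀.ne hlt.ne] at this
    linarith
  · have := ENNReal.toReal_mono (ENNReal.add_lt_top.2 ⟨hft, hlt⟩).ne e2
    rw [ENNReal.toReal_add hft.ne hlt.ne] at this
    linarith

/-- **The `C⁰_t H¹⁰_x` bound** (Tao, p. 22, "the a priori regularity `u ∈ C⁰_t H¹⁰_x`"): an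
`H¹⁰`-continuous curve on `[0,∞)` with finite `H¹⁰` norms is bounded in `H¹⁰` on `[0,T]`. [cite: Tao2016AveragedNS, §4 (4.6)] -/
theorem ContinuousInH10On.exists_forall_Icc_le {u : ℝ → L2C} (hu : ContinuousInH10On (Ici 0) u)
    (hfin : ∀ t ∈ Ici (0 : ℝ), FunctionSpaces.eFourierSobolevNorm 10 (u t) < ∞) (T : ℝ) :
    ∃ C : ℝ, 0 ≤ C ∧ ∀ t ∈ Icc 0 T, FunctionSpaces.eFourierSobolevNorm 10 (u t) ≤ ENNReal.ofReal C := by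
  obtain ⟨C, hC⟩ := isCompact_Icc.exists_bound_of_continuousOn
    ((hu.continuousOn_toReal hfin).mono Icc_subset_Ici_self)
  refine ⟨max C 0, le_max_right _ _, fun t ht => ?_⟩
  have h := hC t ht
  rw [Real.norm_eq_abs, abs_le] at h
  rw [← ENNReal.ofReal_toReal (hfin t ht.1).ne]
  exact ENNReal.ofReal_le_ofReal (h.2.trans (le_max_left _ _))

/-! ### (4.7): the local energies against the `H¹⁰` norm -/

section Apriori

variable {ε₀ : ℝ} {m : ℕ} (𝒟 : CascadeWaveletData ε₀ m)

/-- **(4.7) on the Fourier side**: `(1+ε₀)^{10n} ‖u_{i,n}‖_{L²} ≤ ‖u‖_{H¹⁰}`, because on the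
frequency region of the mode `(i,n)` one has `|ξ| > (1+ε₀)ⁿ`, so
`(1+ε₀)^{20n} ≤ |ξ|^{20} ≤ (1+|ξ|²)^{10}` there (Tao, p. 22: "from Plancherel and the
`C⁰_t H¹⁰_x` bound on `u` we have (4.7)"). In `ℝ≥0∞`, no finiteness needed. [cite: Tao2016AveragedNS, §4 (4.7)] -/
theorem mul_enorm_modeProjection_le (hε : 0 < 1 + ε₀) (i : Fin m) (n : ℤ) (u : L2C) :
    ENNReal.ofReal (((1 + ε₀) ^ n) ^ 10) * ‖modeProjection 𝒟 i n u‖ₑ ≤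
      FunctionSpaces.eFourierSobolevNorm 10 u := by
  set c : ℝ := (1 + ε₀) ^ n with hc
  have hcpos : 0 < c := zpow_pos hε n
  rw [← FunctionSpaces.eFourierSobolevNorm_zero_eq_enorm]
  unfold FunctionSpaces.eFourierSobolevNorm
  have hsq : ENNReal.ofReal (c ^ 10) = (ENNReal.ofReal (c ^ 20)) ^ (1 / 2 : ℝ) := by
    rw [ENNReal.ofReal_rpow_of_nonneg (by positivity) (by norm_num),
      show c ^ 20 = (c ^ 10) ^ (2 : ℕ) by ring, ← Real.rpow_natCast ((c ^ 10)) 2,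
      ← Real.rpow_mul (by positivity)]
    norm_num
  rw [hsq, ← ENNReal.mul_rpow_of_nonneg _ _ (by norm_num : (0 : ℝ) ≤ 1 / 2),
    ← lintegral_const_mul' _ _ ENNReal.ofReal_ne_top]
  refine ENNReal.rpow_le_rpow (lintegral_mono_ae ?_) (by norm_num)
  filter_upwards [fourierFn_modeProjection 𝒟 i n u] with ξ hξ
  change ENNReal.ofReal (c ^ 20) * (ENNReal.ofReal ((1 + ‖ξ‖ ^ 2) ^ (0 : ℝ)) *
    ‖fourierFn (modeProjection 𝒟 i n u) ξ‖ₑ ^ 2) ≤ ENNReal.ofReal ((1 + ‖ξ‖ ^ 2) ^ (10 : ℝ)) *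
      ‖fourierFn u ξ‖ₑ ^ 2
  rw [hξ, Real.rpow_zero, ENNReal.ofReal_one, one_mul]
  by_cases hin : ξ ∈ freqRegion 𝒟 i n
  · rw [indicator_of_mem hin, one_smul]
    refine mul_le_mul_left (ENNReal.ofReal_le_ofReal ?_) _
    have hlt : c < ‖ξ‖ := (𝒟.norm_of_mem_freqRegion hε i n hin).1
    have h2 : c ^ 2 ≤ 1 + ‖ξ‖ ^ 2 := by nlinarith
    calc c ^ 20 = (c ^ 2) ^ 10 := by ring
      _ ≤ (1 + ‖ξ‖ ^ 2) ^ 10 := pow_le_pow_left₀ (by positivity) h2 10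
      _ = (1 + ‖ξ‖ ^ 2) ^ (10 : ℝ) := by norm_cast
  · rw [indicator_of_notMem hin, zero_smul, enorm_zero, zero_pow two_ne_zero, mul_zero]
    exact zero_le

/-- `‖u_{i,n}‖_{L²} ≤ ‖u‖_{H¹⁰}` (in `ℝ≥0∞`). [cite: Tao2016AveragedNS, §4 (4.7)] -/
theorem enorm_modeProjection_le (i : Fin m) (n : ℤ) (u : L2C) :
    ‖modeProjection 𝒟 i n u‖ₑ ≤ FunctionSpaces.eFourierSobolevNorm 10 u := by
  refine le_trans ?_ (enorm_le_eFourierSobolevNorm (by norm_num : (0 : ℝ) ≤ 10) u)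
  rw [← ofReal_norm, ← ofReal_norm]
  exact ENNReal.ofReal_le_ofReal (norm_modeProjection_le 𝒟 i n u)

/-- **(4.7), real form**: `(1 + (1+ε₀)^{10n}) ‖u_{i,n}‖_{L²} ≤ 2 C` whenever `‖u‖_{H¹⁰} ≤ C`. [cite: Tao2016AveragedNS, §4 (4.7)] -/
theorem one_add_mul_norm_modeProjection_le (hε : 0 < 1 + ε₀) (i : Fin m) (n : ℤ) {u : L2C} {C : ℝ}
    (hC : 0 ≤ C) (hu : FunctionSpaces.eFourierSobolevNorm 10 u ≤ ENNReal.ofReal C) :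
    (1 + ((1 + ε₀) ^ n) ^ 10) * ‖modeProjection 𝒟 i n u‖ ≤ 2 * C := by
  have hfin : FunctionSpaces.eFourierSobolevNorm 10 u < ∞ := hu.trans_lt ENNReal.ofReal_lt_top
  have h1 : ‖modeProjection 𝒟 i n u‖ ≤ C := by
    have h := (enorm_modeProjection_le 𝒟 i n u).trans hu
    rwa [← ofReal_norm, ENNReal.ofReal_le_ofReal_iff hC] at h
  have h2 : ((1 + ε₀) ^ n) ^ 10 * ‖modeProjection 𝒟 i n u‖ ≤ C := by
    have h := (mul_enorm_modeProjection_le 𝒟 hε i n u).trans hu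
    rwa [← ofReal_norm, ← ENNReal.ofReal_mul (by positivity), ENNReal.ofReal_le_ofReal_iff hC] at h
  linarith

end Apriori

end Literature.Analysis.FluidPDE.Tao2016
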